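import Summits.Ventures.YMGap.Thresholds.HaarFourthMoment
import HarnessLib

/-!
# The `N = 2` row of the bidegree-(2,2) Haar moments: `∫_{SU(2)} |U₀₀|⁴ dU = 1/3`, `∫_{SU(2)} |U₀₀|²|U₀₁|² dU = 1/6`,
# `∫_{SU(2)} U₀₀U₁₁Ū₀₁Ū₁₀ dU = −1/6`
# (row type C-PRESS, `β = 0` inputs, part 19′)

Cell `pub-ymgap`, seat ds-1 (gen 11). HONEST FRAMING: pure compact-group integration for `G ≅ SU(2)`; nothing lattice-specific, nothing
about the continuum or the Clay problem. Kernel theorems only, 0 compute, no definitions.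

Part 19a (`HaarFourthMomentSUN`) proves `∫|U₀₀|⁴ = 2/(N(N+1))` and `∫|U₀₀|²|U₀₁|² = 1/(N(N+1))` for `N ≥ 3` (its phase-twist step needs a third
index). The same values hold for `N = 2` — `1/3` and `1/6` — and follow at once from part 10's quaternion-coordinate moments
(`x = (Re U₀₀, Im U₀₀, Re U₀₁, Im U₀₁)` uniform on `S³`: `∫x₀⁴ = 1/8`, `∫x₀²x_a² = 1/24`): `|U₀₀|² = x₀² + x₁²`, `|U₀₁|² = x₂² + x₃²`, and the
twist by `quatMatrix i` supplies the two pair moments not containing `x₀`. Everything here is proved. [folklore]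
-/

noncomputable section

open MeasureTheory Complex
open Literature.MathematicalPhysics.QuantumLattice Literature.MathematicalPhysics.QuantumFieldTheory

namespace Summit.Ventures.YMGap.HaarFourthMoment

section Model

variable {G : Type*} [Group G] [TopologicalSpace G] [IsTopologicalGroup G] [CompactSpace G]
  [MeasurableSpace G] [BorelSpace G] (ρ : G →* Matrix (Fin 2) (Fin 2) ℂ)

/-- `∫ x₁² x₃² = ∫ x₀² x₂²` and `∫ x₁² x₂² = ∫ x₀² x₃²` (left twist by `quatMatrix i`: `(x₀,x₁,x₂,x₃) ↦ (−x₁,x₀,−x₃,x₂)`). [folklore] -/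
theorem integral_im00_sq_mul_pairs (hρ : IsSpecialUnitaryModel ρ) :
    ∫ g, (ρ g 0 0).im ^ 2 * (ρ g 0 1).im ^ 2 ∂haarProbability G = ∫ g, (ρ g 0 0).re ^ 2 * (ρ g 0 1).re ^ 2 ∂haarProbability G ∧
      ∫ g, (ρ g 0 0).im ^ 2 * (ρ g 0 1).re ^ 2 ∂haarProbability G = ∫ g, (ρ g 0 0).re ^ 2 * (ρ g 0 1).im ^ 2 ∂haarProbability G := by
  constructor
  · have h := integral_comp_quat ρ hρ (a := 0) (b := 1) (c := 0) (d := 0) (by norm_num) (fun s _ u _ => s ^ 2 * u ^ 2)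
    have hpt : ∀ g : G, ((0 : ℝ) * (ρ g 0 0).re - 1 * (ρ g 0 0).im - 0 * (ρ g 0 1).re - 0 * (ρ g 0 1).im) ^ 2 *
        ((0 : ℝ) * (ρ g 0 1).re - 1 * (ρ g 0 1).im + 0 * (ρ g 0 0).re + 0 * (ρ g 0 0).im) ^ 2 =
        (ρ g 0 0).im ^ 2 * (ρ g 0 1).im ^ 2 := fun g => by ring
    simp only [hpt] at h
    exact h
  · have h := integral_comp_quat ρ hρ (a := 0) (b := 1) (c := 0) (d := 0) (by norm_num) (fun s _ _ v => s ^ 2 * v ^ 2)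
    have hpt : ∀ g : G, ((0 : ℝ) * (ρ g 0 0).re - 1 * (ρ g 0 0).im - 0 * (ρ g 0 1).re - 0 * (ρ g 0 1).im) ^ 2 *
        ((0 : ℝ) * (ρ g 0 1).im + 1 * (ρ g 0 1).re - 0 * (ρ g 0 0).im + 0 * (ρ g 0 0).re) ^ 2 =
        (ρ g 0 0).im ^ 2 * (ρ g 0 1).re ^ 2 := fun g => by ring
    simp only [hpt] at h
    exact h

/-- ★ **`∫ |ρ(g)₀₀|⁴ dg = 1/3` for `G ≅ SU(2)`** (`= 2/(N(N+1))` at `N = 2`). [folklore] -/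
theorem integral_normSq_entry_sq_su2Model (hρ : IsSpecialUnitaryModel ρ) :
    ∫ g, Complex.normSq (ρ g 0 0) ^ 2 ∂haarProbability G = 1 / 3 := by
  obtain ⟨c0, c1, c2, c3⟩ := continuous_coords ρ hρ
  have hpt : ∀ g : G, Complex.normSq (ρ g 0 0) ^ 2 =
      (ρ g 0 0).re ^ 4 + 2 * ((ρ g 0 0).re ^ 2 * (ρ g 0 0).im ^ 2) + (ρ g 0 0).im ^ 4 := fun g => by
    rw [Complex.normSq_apply]; ring
  simp_rw [hpt]
  have i1 : Integrable (fun g => (ρ g 0 0).re ^ 4) (haarProbability G) :=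
    Continuous.integrable_of_hasCompactSupport (by fun_prop) (HasCompactSupport.of_compactSpace _)
  have i2 : Integrable (fun g => 2 * ((ρ g 0 0).re ^ 2 * (ρ g 0 0).im ^ 2)) (haarProbability G) :=
    Continuous.integrable_of_hasCompactSupport (by fun_prop) (HasCompactSupport.of_compactSpace _)
  have i3 : Integrable (fun g => (ρ g 0 0).im ^ 4) (haarProbability G) :=
    Continuous.integrable_of_hasCompactSupport (by fun_prop) (HasCompactSupport.of_compactSpace _)
  have i12 : Integrable (fun g => (ρ g 0 0).re ^ 4 + 2 * ((ρ g 0 0).re ^ 2 * (ρ g 0 0).im ^ 2)) (haarProbability G) := i1.add i2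
  rw [integral_add i12 i3, integral_add i1 i2, integral_const_mul, integral_re00_sq_mul_im00_sq ρ hρ,
    integral_im00_pow_four ρ hρ, integral_re00_pow_four ρ hρ]
  norm_num

/-- ★ **`∫ |ρ(g)₀₀|² |ρ(g)₀₁|² dg = 1/6` for `G ≅ SU(2)`** (`= 1/(N(N+1))` at `N = 2`). [folklore] -/
theorem integral_normSq_mul_normSq_su2Model (hρ : IsSpecialUnitaryModel ρ) :
    ∫ g, Complex.normSq (ρ g 0 0) * Complex.normSq (ρ g 0 1) ∂haarProbability G = 1 / 6 := by
  obtain ⟨c0, c1, c2, c3⟩ := continuous_coords ρ hρ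
  obtain ⟨h13, h12⟩ := integral_im00_sq_mul_pairs ρ hρ
  have hpt : ∀ g : G, Complex.normSq (ρ g 0 0) * Complex.normSq (ρ g 0 1) =
      (ρ g 0 0).re ^ 2 * (ρ g 0 1).re ^ 2 + (ρ g 0 0).re ^ 2 * (ρ g 0 1).im ^ 2 +
        (ρ g 0 0).im ^ 2 * (ρ g 0 1).re ^ 2 + (ρ g 0 0).im ^ 2 * (ρ g 0 1).im ^ 2 := fun g => by
    rw [Complex.normSq_apply, Complex.normSq_apply]; ring
  simp_rw [hpt]
  have i1 : Integrable (fun g => (ρ g 0 0).re ^ 2 * (ρ g 0 1).re ^ 2) (haarProbability G) :=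
    Continuous.integrable_of_hasCompactSupport (by fun_prop) (HasCompactSupport.of_compactSpace _)
  have i2 : Integrable (fun g => (ρ g 0 0).re ^ 2 * (ρ g 0 1).im ^ 2) (haarProbability G) :=
    Continuous.integrable_of_hasCompactSupport (by fun_prop) (HasCompactSupport.of_compactSpace _)
  have i3 : Integrable (fun g => (ρ g 0 0).im ^ 2 * (ρ g 0 1).re ^ 2) (haarProbability G) :=
    Continuous.integrable_of_hasCompactSupport (by fun_prop) (HasCompactSupport.of_compactSpace _)
  have i4 : Integrable (fun g => (ρ g 0 0).im ^ 2 * (ρ g 0 1).im ^ 2) (haarProbability G) :=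
    Continuous.integrable_of_hasCompactSupport (by fun_prop) (HasCompactSupport.of_compactSpace _)
  have i12 : Integrable (fun g => (ρ g 0 0).re ^ 2 * (ρ g 0 1).re ^ 2 + (ρ g 0 0).re ^ 2 * (ρ g 0 1).im ^ 2) (haarProbability G) :=
    i1.add i2
  have i123 : Integrable (fun g => (ρ g 0 0).re ^ 2 * (ρ g 0 1).re ^ 2 + (ρ g 0 0).re ^ 2 * (ρ g 0 1).im ^ 2 +
      (ρ g 0 0).im ^ 2 * (ρ g 0 1).re ^ 2) (haarProbability G) := i12.add i3
  rw [integral_add i123 i4, integral_add i12 i3, integral_add i1 i2, h13, h12,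
    integral_re00_sq_mul_re01_sq ρ hρ, integral_re00_sq_mul_im01_sq ρ hρ, integral_re00_pow_four ρ hρ]
  norm_num

end Model

/-! ### The concrete group `SU(2)` -/

/-- ★ **`∫_{SU(2)} |U₀₀|⁴ dU = 1/3`.** [folklore] -/
theorem integral_normSq_entry_sq_su2 :
    ∫ U, Complex.normSq ((U : Matrix (Fin 2) (Fin 2) ℂ) 0 0) ^ 2 ∂haarProbability (Matrix.specialUnitaryGroup (Fin 2) ℂ) = 1 / 3 := by
  have h := integral_normSq_entry_sq_su2Model (fundamentalRep (Fin 2)) (TorusAreaLaw.isSpecialUnitaryModel_fundamentalRep 2)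
  simpa only [fundamentalRep_apply] using h

/-- ★ **`∫_{SU(2)} |U₀₀|² |U₀₁|² dU = 1/6`.** [folklore] -/
theorem integral_normSq_mul_normSq_su2 :
    ∫ U, Complex.normSq ((U : Matrix (Fin 2) (Fin 2) ℂ) 0 0) * Complex.normSq ((U : Matrix (Fin 2) (Fin 2) ℂ) 0 1)
      ∂haarProbability (Matrix.specialUnitaryGroup (Fin 2) ℂ) = 1 / 6 := by
  have h := integral_normSq_mul_normSq_su2Model (fundamentalRep (Fin 2)) (TorusAreaLaw.isSpecialUnitaryModel_fundamentalRep 2)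
  simpa only [fundamentalRep_apply] using h

/-- ★ **The `SU(2)` exchange entry: `∫_{SU(2)} U₀₀ U₁₁ conj(U₀₁) conj(U₁₀) dU = −1/6`** (`= −1/((N−1)N(N+1))` at `N = 2`): the second row of
`U ∈ SU(2)` is `(−conj U₀₁, conj U₀₀)` (`su2_apply_10`, `su2_apply_11`), so the integrand is `−|U₀₀|²|U₀₁|²`. [folklore] -/
theorem integral_exchange_su2 :
    ∫ U, (U : Matrix (Fin 2) (Fin 2) ℂ) 0 0 * (U : Matrix (Fin 2) (Fin 2) ℂ) 1 1 * (starRingEnd ℂ) ((U : Matrix (Fin 2) (Fin 2) ℂ) 0 1) *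
        (starRingEnd ℂ) ((U : Matrix (Fin 2) (Fin 2) ℂ) 1 0) ∂haarProbability (Matrix.specialUnitaryGroup (Fin 2) ℂ) = -1 / 6 := by
  have hpt : ∀ U : Matrix.specialUnitaryGroup (Fin 2) ℂ,
      (U : Matrix (Fin 2) (Fin 2) ℂ) 0 0 * (U : Matrix (Fin 2) (Fin 2) ℂ) 1 1 * (starRingEnd ℂ) ((U : Matrix (Fin 2) (Fin 2) ℂ) 0 1) *
        (starRingEnd ℂ) ((U : Matrix (Fin 2) (Fin 2) ℂ) 1 0) =
      ((-(Complex.normSq ((U : Matrix (Fin 2) (Fin 2) ℂ) 0 0) * Complex.normSq ((U : Matrix (Fin 2) (Fin 2) ℂ) 0 1)) : ℝ) : ℂ) := by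
    intro U
    rw [su2_apply_11 U, su2_apply_10 U, map_neg, Complex.conj_conj]
    push_cast
    rw [← Complex.mul_conj, ← Complex.mul_conj]
    ring
  simp_rw [hpt]
  rw [integral_complex_ofReal, integral_neg, integral_normSq_mul_normSq_su2]
  push_cast
  ring

end Summit.Ventures.YMGap.HaarFourthMoment
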